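import Mathlib
import HarnessLib
import Summits.Parity.BatemanHorn.Theorems.IsogenyRedeiSplitBlockJacobiWeylDefs

/-!
# Vocabulary of line `Sketch` (crux `SplitBlockJacobiCorner`, stmt-Parity-15002):
# definitions only, verbatim from the registered skeleton

The concrete finite sums through which the line's two remaining stubs (`stub_boxInputs`,
`stub_mbb_of_boxInputs`) are stated, over the landed vocabulary `rootWeylSum h q = S(h,q)` and
`twistedSum h P₁ P₁' P₂ P₂' = T_h` of `…SplitBlockJacobiWeylDefs`:

* `smoothTwistedBoxSum k d d' A A' B B'` — the K1′ kernel `Σ_{n,q ≡ 1 (4)} (dn|d'q)·S(k, dn·d'q)`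
  over a box `(A,A'] × (B,B']`;
* `SmoothTwistedTypeI2Box η` — **K1′**, the line's HYPOTHESIS (an OPEN smooth bilinear estimate:
  Merikoski's Type-I₂ sum for `n²+1`, Jacobi-twisted, with tiny levels inside symbol and modulus);
* `shortFactorTrilinearSum k α γ β M R T` — the K2′ kernel, a trilinear form with a short factor;
* `ShortFactorTwistedTypeIIGen c η` — **K2′**, the line's HYPOTHESIS (an OPEN trilinear Type-II
  estimate with a cross character);
* `MixedBilinearBalanced δ₀` — **MBB**, drefute-g2's repaired (aspect-bounded) corner hypothesis, the
  conclusion of `stub_mbb_of_boxInputs` and the hypothesis of the landed corner implication.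

None of K1′, K2′, MBB is a cited fact: they are open bilinear estimates (the line's bets).  The bodies
are copied verbatim from §1 of the skeleton `work/SplitBlockJacobiCorner.lean` (line Sketch) so that
the stubs can land against these names.  Only the definitional unfolding `mixedBilinearBalanced_iff`
(registered stub form) is stated; nothing else is proved here.
-/

noncomputable section

open Finset Filter

namespace Summit.Parity.BatemanHorn.Cruxes.SplitBlockJacobiCorner.Sketch

open Summit.Parity.BatemanHorn.Cruxes.SplitBlockJacobi.CofactorRootDiscrepancy

/-- The **K1′ kernel** `smoothTwistedBoxSum k d d' A A' B B' :=
Σ_{n ∈ (A,A'], n ≡ 1 (4)} Σ_{q ∈ (B,B'], q ≡ 1 (4)} (dn | d'q) · S(k, dn·d'q)`: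
one free variable per side (`≡ 1 (mod 4)`, no primality), tiny levels `d, d'` carried INSIDE the
Jacobi symbol and the modulus, sub-dyadic boxes. Verbatim from the line skeleton. -/
def smoothTwistedBoxSum (k : ℤ) (d d' A A' B B' : ℕ) : ℂ :=
  ∑ n ∈ (Finset.Ioc A A').filter (fun n : ℕ => n % 4 = 1),
    ∑ q ∈ (Finset.Ioc B B').filter (fun q : ℕ => q % 4 = 1),
      (jacobiSym ((d * n : ℕ) : ℤ) (d' * q) : ℂ) * rootWeylSum k (d * n * (d' * q))

/-- **`SmoothTwistedTypeI2Box η` (K1′) — the line's HYPOTHESIS** (not a cited fact: an OPEN smooth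
bilinear estimate, the Jacobi-twisted analogue of Merikoski's Type-I₂ sum for `n² + 1`, which is
open already untwisted; it is the first conjunct of the open stub `stub_boxInputs` and a hypothesis
of `stub_mbb_of_boxInputs`): power saving `(dA·d'B)^{-η}` for `smoothTwistedBoxSum` in
near-balanced sub-dyadic boxes (sides `dA`, `d'B`, each at most the other to the power `1+η`),
uniformly for levels `1 ≤ d, d' ≤ (dA)^{η/4}` and frequencies `0 < |k| ≤ (dA)^{η}`.
Verbatim from the line skeleton. -/
def SmoothTwistedTypeI2Box (η : ℝ) : Prop :=
  ∃ N₀ : ℕ, ∀ d d' A A' B B' : ℕ, 1 ≤ d → 1 ≤ d' → N₀ ≤ d * A → N₀ ≤ d' * B →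
    A ≤ A' → A' ≤ 2 * A → B ≤ B' → B' ≤ 2 * B →
    ((d' * B : ℕ) : ℝ) ≤ ((d * A : ℕ) : ℝ) ^ (1 + η) → ((d * A : ℕ) : ℝ) ≤ ((d' * B : ℕ) : ℝ) ^ (1 + η) →
    (d : ℝ) ≤ ((d * A : ℕ) : ℝ) ^ (η / 4) → (d' : ℝ) ≤ ((d * A : ℕ) : ℝ) ^ (η / 4) →
      ∀ k : ℤ, k ≠ 0 → (|k| : ℝ) ≤ ((d * A : ℕ) : ℝ) ^ η →
        ‖smoothTwistedBoxSum k d d' A A' B B'‖ ≤ ((d * A * (d' * B) : ℕ) : ℝ) ^ (1 - η)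

/-- The **K2′ kernel** `shortFactorTrilinearSum k α γ β M R T :=
Σ_{m ∈ (M,2M]} Σ_{r ∈ (R,2R]} Σ_{q ∈ (T,2T], q ≡ 1 (4), (mr,q)=1} α(m) γ(r) β(q) (mr|q) S(k, mrq)`:
short factor `m` and cofactor `r` with arbitrary coefficients, third variable `q ≡ 1 (4)` with an
arbitrary coefficient, cross twist `(mr|q)`, modulus the literal product `m·r·q`.
Verbatim from the line skeleton. -/
def shortFactorTrilinearSum (k : ℤ) (α γ β : ℕ → ℂ) (M R T : ℕ) : ℂ :=
  ∑ m ∈ Finset.Ioc M (2 * M), ∑ r ∈ Finset.Ioc R (2 * R),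
    ∑ q ∈ (Finset.Ioc T (2 * T)).filter (fun q : ℕ => q % 4 = 1 ∧ Nat.Coprime (m * r) q),
      α m * γ r * β q * (jacobiSym ((m * r : ℕ) : ℤ) q : ℂ) * rootWeylSum k (m * r * q)

/-- **`ShortFactorTwistedTypeIIGen c η` (K2′) — the line's HYPOTHESIS** (not a cited fact: an OPEN
trilinear Type-II estimate with a cross character; it is the second conjunct of the open stub
`stub_boxInputs`, used with `c = 1/4 + η/100`, and a hypothesis of `stub_mbb_of_boxInputs`):
power saving `(MRT)^{-η}` for `shortFactorTrilinearSum` with a short factor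
`(MRT)^{η/25} ≤ M ≤ (MRT)^{c}`, in both orientations (`T ≤ (MR)^{1+η}` and `MR ≤ T^{1+η}`), for all
unit-bounded coefficients on the three variables and all frequencies `0 < |k| ≤ (MRT)^{η/25}`.
Verbatim from the line skeleton. -/
def ShortFactorTwistedTypeIIGen (c η : ℝ) : Prop :=
  ∃ N₀ : ℕ, ∀ M R T : ℕ, N₀ ≤ M * R → N₀ ≤ T →
    (T : ℝ) ≤ ((M * R : ℕ) : ℝ) ^ (1 + η) → ((M * R : ℕ) : ℝ) ≤ (T : ℝ) ^ (1 + η) →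
    ((M * R * T : ℕ) : ℝ) ^ (η / 25) ≤ M → (M : ℝ) ≤ ((M * R * T : ℕ) : ℝ) ^ c →
      ∀ (α γ β : ℕ → ℂ), (∀ m, ‖α m‖ ≤ 1) → (∀ r, ‖γ r‖ ≤ 1) → (∀ q, ‖β q‖ ≤ 1) →
        ∀ k : ℤ, k ≠ 0 → (|k| : ℝ) ≤ ((M * R * T : ℕ) : ℝ) ^ (η / 25) →
          ‖shortFactorTrilinearSum k α γ β M R T‖ ≤ ((M * R * T : ℕ) : ℝ) ^ (1 - η)

/-- **`MixedBilinearBalanced δ₀` (MBB) — the line's HYPOTHESIS for the corner** (not a cited fact: an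
OPEN aspect-bounded bilinear power saving for the twisted root Weyl sum
`T_h = Σ_{Q,Q'} (Q|Q') S(h, QQ')` over boxes of primes `≡ 1 (mod 4)`, drefute-g2's repaired form; it
is the conclusion of `stub_mbb_of_boxInputs` and the hypothesis of the landed corner implication
`splitBlockJacobiCorner_of_mixedBilinearBalanced`; untwisted analogue of K2′ in print:
Grimmelt–Merikoski 2025 Thm 1.5, tree fact
`Literature.NumberTheory.Sieve.GM2025.grimmeltMerikoski2025_thm15` (window side)):
for `P₀ ≤ P₁ ≤ P₁' ≤ 2P₁`, `P₁ ≤ P₂ ≤ P₂' ≤ 2P₂`, `P₂ ≤ 8 P₁^{1+δ₀}` and `0 < |h| ≤ (P₁P₂)^{δ₀}`,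
`‖twistedSum h P₁ P₁' P₂ P₂'‖ ≤ (P₁P₂)^{1−δ₀}`. Verbatim from the line skeleton. -/
def MixedBilinearBalanced (δ₀ : ℝ) : Prop :=
  ∃ P₀ : ℕ, ∀ P₁ P₁' P₂ P₂' : ℕ, P₀ ≤ P₁ → P₁ ≤ P₁' → P₁' ≤ 2 * P₁ → P₁ ≤ P₂ → P₂ ≤ P₂' →
    P₂' ≤ 2 * P₂ → (P₂ : ℝ) ≤ 8 * (P₁ : ℝ) ^ (1 + δ₀) →
      ∀ h : ℤ, h ≠ 0 → (|h| : ℝ) ≤ ((P₁ * P₂ : ℕ) : ℝ) ^ δ₀ →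
        ‖twistedSum h P₁ P₁' P₂ P₂'‖ ≤ ((P₁ * P₂ : ℕ) : ℝ) ^ (1 - δ₀)

/-- **Unfolding `MixedBilinearBalanced`** (registered stub form, so that this definitions file lands
against a registered name): MBB written out over the landed `twistedSum`; definitional. -/
theorem mixedBilinearBalanced_iff :
    ∀ δ₀ : ℝ, MixedBilinearBalanced δ₀ ↔ ∃ P₀ : ℕ, ∀ P₁ P₁' P₂ P₂' : ℕ, P₀ ≤ P₁ → P₁ ≤ P₁' → P₁' ≤ 2 * P₁ → P₁ ≤ P₂ → P₂ ≤ P₂' → P₂' ≤ 2 * P₂ → (P₂ : ℝ) ≤ 8 * (P₁ : ℝ) ^ (1 + δ₀) → ∀ h : ℤ, h ≠ 0 → (|h| : ℝ) ≤ ((P₁ * P₂ : ℕ) : ℝ) ^ δ₀ → ‖twistedSum h P₁ P₁' P₂ P₂'‖ ≤ ((P₁ * P₂ : ℕ) : ℝ) ^ (1 - δ₀) :=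
  fun _ => Iff.rfl

end Summit.Parity.BatemanHorn.Cruxes.SplitBlockJacobiCorner.Sketch

end
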